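import Literature.NumberTheory.EllipticCurves.Isogeny
import Literature.NumberTheory.EllipticCurves.ModularCurve
import Literature.NumberTheory.EllipticCurves.GaloisAction
import Literature.NumberTheory.EllipticCurves.IsogenyAnalyticScalarThreeFreeProofs
import HarnessLib

/-!
# The analytic representation of a `ℚ`-isogeny between two curves of an isogeny class without rational `3`-isogeny:
# a scalar `α` with `αΛ₂ ⊆ Λ₁`, `dΛ₁ ⊆ αΛ₂`, `3 ∤ d` (one named fact)

Topic `NumberTheory/EllipticCurves`; ONE named literature fact (`def … : Prop`, D-0014; no `sorry`, no instance, no notation) and its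
discharge `isogenyScalar_threeFree_of_irreducible_holds` (see «Discharge» below). Filed by the BSD cell
`bsd-stepL` (seat `bsd-stepL-tam3-p1` g27, LEAD of crux stmt-BirchSwinnertonDyer-24801 `CartanOnePlaceDegreeLawAtThree`): it is the «isogeny scaling» clause of the
split-side transport datum `CartanCover.SplitSideTransportAtThree` of that crux's line `Lines/lattice.lean` (tam3-p1 g26 memo NUM-LINES-AND-D1-DESIGN §4 (iv)).

* `isogenyScalar_threeFree_of_irreducible` — for elliptic curves `V ~ W₁ ~ W₂` over `ℚ` (isogenous over `ℚ`) with `E[3] = V[3]` an irreducible Galois module, and period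
  pairs `L₁, L₂` of (the complex base changes of) `W₁, W₂` (`IsNeronLatticeOf`: `g₂ = c₄∕12`, `g₃ = c₆∕216`), there are `α ∈ ℂ` and `d ∈ ℕ` with `3 ∤ d`, `α·Λ₂ ⊆ Λ₁` and
  `d·Λ₁ ⊆ α·Λ₂` (`Λᵢ = Lᵢ.lattice`). PRINT: a `ℚ`-isogeny `φ : W₂ → W₁` of degree `d` has an analytic representation `z ↦ αz`, `ℂ∕Λ₂ → ℂ∕Λ₁`, with `αΛ₂ ⊆ Λ₁` of index
  `d` (Silverman AEC VI.4.1 (b) with VI.5.3; III.4.10–4.12, III.6.1–6.2: `φ̂ ∘ φ = [d]`, so `d·α⁻¹Λ₁ ⊆ Λ₂`); inside a `ℚ`-isogeny class any two curves are joined by a CYCLIC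
  isogeny (compose and divide by the largest `[n]`), and a cyclic `ℚ`-isogeny of degree divisible by `3` out of `W₂` contains a rational subgroup of order `3`, i.e. a rational
  `3`-isogeny of `W₂`, whence of `V` (the connecting isogeny `V → W₂` may be taken of degree prime to `3` by the same argument applied inductively, and then `V[3] ≅ W₂[3]`),
  contradicting irreducibility of `V[3]` (Silverman III.4.12, Cremona §3.8).

## Discharge

`isogenyScalar_threeFree_of_irreducible_holds` (appended 2026-08-29, bsd-stepL `defn-ty1` g42): the fact is a THEOREM, by
`exists_isogenyScalar_threeFree_of_irreducible` of the sibling proofs file `IsogenyAnalyticScalarThreeFreeProofs.lean` (rational analytic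
multiplier of a `ℚ`-isogeny, Silverman VI.4.1 (b) + Galois descent; the `ℚ`-isogeny `z ↦ cz` of a rational lattice inclusion and its degree;
Cauchy + irreducibility of `V[3]` + algebraicity of torsion to divide the scalar by `3` while the index is divisible by `3`). The statement of
the `def` below is unchanged.

## Honest framing ∕ what this fact does NOT say

Nothing about minimal models, Manin constants, real periods or degrees of parametrisations; `α` is not claimed real or positive; `d` is the degree of ONE isogeny `W₂ → W₁`, not
claimed minimal. DISCHARGE ROUTE as first sketched here (tam3-p1 g27): the tree's `Isogeny` structure carries the rational map; its analytic representation on the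
period lattices is the tree's `Isogeny.exists_mul_baseChange_apply_eq` with the uniformisation `PeriodPair.exists_addMonoidHom_of_g₂_g₃'` — carried out in the
sibling proofs file (see «Discharge» above). presearch (tam3-p1 g27): the analytic representation of
isogenies is textbook (Silverman VI.4.1); the tree has `Isogeny`, `IsIsogenous`, `LFunction_eq_of_isIsogenous_holds`, `IsNeronLatticeOf`, but no lattice-level statement of an
isogeny (queries: `lean search 'lattice.*Isogen'`, `'Isogeny.*PeriodPair'` — none).

## References

* J. H. Silverman, *The Arithmetic of Elliptic Curves*, GTM 106 (2009), VI.4.1, VI.5.3, III.4.10–4.12, III.6.1–6.2. [cite: SilvermanAEC2009, VI.4.1 (b), III.4.12 and III.6.2]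
* J. E. Cremona, *Algorithms for Modular Elliptic Curves* (1997), §3.8 (isogeny classes over `ℚ`). [cite: Cremona1997, §3.8]
-/

noncomputable section

namespace Literature.NumberTheory.EllipticCurves

open WeierstrassCurve Literature.NumberTheory.EllipticCurves.ModularForms

/-- **Analytic isogeny scalar with `3`-free degree inside an isogeny class with `E[3]` irreducible.** For elliptic `V, W₁, W₂ ∕ ℚ` with `V ~ W₁`, `V ~ W₂`
(`ℚ`-isogenous), `V[3]` irreducible, and period pairs `L₁`, `L₂` of `W₁`, `W₂` (`IsNeronLatticeOf`), there are `α ∈ ℂ` and `d ∈ ℕ`, `3 ∤ d`, with `α·L₂.lattice ⊆ L₁.lattice`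
and `d·L₁.lattice ⊆ α·L₂.lattice` (the analytic representation of a cyclic `ℚ`-isogeny `W₂ → W₁`, of degree `d` prime to `3`).
[cite: SilvermanAEC2009, VI.4.1 (b), III.4.12 and III.6.2] [cite: Cremona1997, §3.8] -/
def isogenyScalar_threeFree_of_irreducible : Prop :=
  ∀ (V W₁ W₂ : WeierstrassCurve ℚ) [V.IsElliptic] [W₁.IsElliptic] [W₂.IsElliptic] (L₁ L₂ : PeriodPair),
    IsNeronLatticeOf (W₁.baseChange ℂ) L₁ → IsNeronLatticeOf (W₂.baseChange ℂ) L₂ →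
    V.HasIrreducibleModPGaloisRep 3 → V.IsIsogenous W₁ → V.IsIsogenous W₂ →
    ∃ (α : ℂ) (d : ℕ), ¬ 3 ∣ d ∧ (∀ x ∈ L₂.lattice, α * x ∈ L₁.lattice) ∧
      (∀ y ∈ L₁.lattice, ∃ x ∈ L₂.lattice, (d : ℂ) * y = α * x)

/-- **DISCHARGE of `isogenyScalar_threeFree_of_irreducible`** (Silverman AEC VI.4.1 (b), III.4.12, III.6.2): the analytic scalar with
`3`-free index exists — `exists_isogenyScalar_threeFree_of_irreducible` (`IsogenyAnalyticScalarThreeFreeProofs.lean`).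
[cite: SilvermanAEC2009, VI.4.1 (b), III.4.12 and III.6.2] [cite: Cremona1997, §3.8] -/
theorem isogenyScalar_threeFree_of_irreducible_holds : isogenyScalar_threeFree_of_irreducible :=
  fun V W₁ W₂ _ _ _ L₁ L₂ hL₁ hL₂ hirr h₁ h₂ =>
    exists_isogenyScalar_threeFree_of_irreducible V W₁ W₂ L₁ L₂ hL₁ hL₂ hirr h₁ h₂

end Literature.NumberTheory.EllipticCurves

end
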